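import Mathlib.Analysis.Convex.Segment
import Summits.ValiantsHypothesis.ValiantsHypothesis.Theorems.DivisionGapZeroOneTransferStubPickParityAux2
import Summits.ValiantsHypothesis.ValiantsHypothesis.Theorems.DivisionGapZeroOneTransferStubPickParityAux3
import Summits.ValiantsHypothesis.ValiantsHypothesis.Theorems.DivisionGapZeroOneTransferStubPickParityAux4
import Literature.Topology.PlaneTopology.PolygonUmlaufsatz
import HarnessLib

/-!
# Winding numbers of closed walks on the triangular lattice, V: the walk as a simple polygon; the turning number

Fifth proof file for the registered stub `stub_pickParity` of line `charged-uncharged` of crux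
`ZeroOneTransfer` (stmt-ValiantsHypothesis-5066, route DivisionGap); sequel to
`…StubPickParityAux2.lean` (winding numbers, Pick in winding form), `…Aux3.lean` (exterior angles
of lattice steps) and `…Aux4.lean` (unit segments meet only at endpoints).  Here the global
topological input enters, through the tree's polygonal Umlaufsatz
`Literature.Topology.PlaneTopology.IsSimplePolygon.sum_extAngle_eq` (Hopf 1935, Satz I):

* the vertex map `vtx` of a SIMPLE closed triangular-lattice walk of period `≥ 3` is a simple
  closed polygon in the sense of `IsSimplePolygon` (`isSimplePolygon_vtx`);
* its exterior angles are `π/4 · turn` (`extAngle_vtx`);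
* **its turns over one period sum to `±8`** (`sum_turn_eq`, registered sub-goal
  `pickParity_sum_turn_eq`: the tangent turns once, `±360° = ±8 · 45°`).
[cite: Hopf1935, Satz I] [cite: Kasteleyn1961]
-/

namespace Summit.ValiantsHypothesis.ValiantsHypothesis.Theorems.DivisionGapZeroOneTransfer

-- the single-problem summit's namespace `Summit.ValiantsHypothesis.ValiantsHypothesis` repeats
set_option linter.dupNamespace false

open Finset Literature.Probability.LatticeModels Literature.Topology.PlaneTopology

/-! ### The vertices as complex numbers -/

namespace TriWalk

variable {ℓ : ℕ} (c : TriWalk ℓ)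

/-- Reading lattice points as complex numbers is injective. [folklore] -/
theorem pt_injective {p q : ℤ × ℤ} (h : (⟨(p.1 : ℝ), (p.2 : ℝ)⟩ : ℂ) = ⟨(q.1 : ℝ), (q.2 : ℝ)⟩) :
    p = q := by
  have h1 := congrArg Complex.re h
  have h2 := congrArg Complex.im h
  simp only at h1 h2
  exact Prod.ext (by exact_mod_cast h1) (by exact_mod_cast h2)

/-- `vtx i` is the vertex `v m` for any natural representative `m` of `i` modulo the period.
[folklore] -/
theorem vtx_eq_of_emod_eq {i : ℤ} {m : ℕ} (h : i % ℓ = (m : ℤ) % ℓ) :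
    c.vtx i = ⟨((c.v m).1 : ℝ), ((c.v m).2 : ℝ)⟩ := by
  rw [TriWalk.vtx_def, h, ← Int.natCast_mod, Int.toNat_natCast, c.v_mod]

/-- A natural representative of an integer index modulo the (positive) period. [folklore] -/
theorem exists_nat_repr (hn : 0 < ℓ) (i : ℤ) : ∃ m : ℕ, m < ℓ ∧ i % ℓ = (m : ℤ) % ℓ := by
  refine ⟨(i % ℓ).toNat, ?_, ?_⟩
  · have := Int.emod_lt_of_pos i (show (0 : ℤ) < ℓ by exact_mod_cast hn)
    omega
  · rw [Int.toNat_of_nonneg (Int.emod_nonneg _ (by exact_mod_cast hn.ne')), Int.emod_emod_of_dvd _ dvd_rfl]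

/-- Shifting an index with a known natural representative. [folklore] -/
theorem vtx_add_natCast {i : ℤ} {m : ℕ} (h : i % ℓ = (m : ℤ) % ℓ) (k : ℕ) :
    c.vtx (i + k) = ⟨((c.v (m + k)).1 : ℝ), ((c.v (m + k)).2 : ℝ)⟩ :=
  c.vtx_eq_of_emod_eq (by push_cast; exact Int.ModEq.add_right _ h)

/-- Shifting an index by one with a known natural representative. [folklore] -/
theorem vtx_add_one {i : ℤ} {m : ℕ} (h : i % ℓ = (m : ℤ) % ℓ) :
    c.vtx (i + 1) = ⟨((c.v (m + 1)).1 : ℝ), ((c.v (m + 1)).2 : ℝ)⟩ := by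
  simpa using c.vtx_add_natCast h 1

/-- Shifting an index back by one with a known natural representative. [folklore] -/
theorem vtx_sub_one (hn : 0 < ℓ) {i : ℤ} {m : ℕ} (h : i % ℓ = (m : ℤ) % ℓ) :
    c.vtx (i - 1) = ⟨((c.v (m + (ℓ - 1))).1 : ℝ), ((c.v (m + (ℓ - 1))).2 : ℝ)⟩ := by
  refine c.vtx_eq_of_emod_eq ?_
  have e : ((m + (ℓ - 1) : ℕ) : ℤ) = ((m : ℤ) - 1) + ℓ := by push_cast [Nat.cast_sub hn]; ring
  rw [e, Int.add_emod_right]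
  exact Int.ModEq.sub_right 1 h

/-- The vertex map is periodic. [folklore] -/
theorem vtx_periodic : Function.Periodic c.vtx ℓ := fun i => by
  simp only [TriWalk.vtx_def, Int.add_emod_right]

/-- Membership in a closed segment between lattice points, in coordinates: a point of
`[P, P + d]` is `P + s·d` with `s ∈ [0,1]`. [folklore] -/
theorem exists_param_of_mem_segment {P d : ℤ × ℤ} {z : ℂ}
    (hz : z ∈ segment ℝ (⟨(P.1 : ℝ), (P.2 : ℝ)⟩ : ℂ) ⟨((P + d).1 : ℝ), ((P + d).2 : ℝ)⟩) :
    ∃ s : ℝ, (0 ≤ s ∧ s ≤ 1) ∧ z.re = P.1 + s * d.1 ∧ z.im = P.2 + s * d.2 := by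
  obtain ⟨a, b, ha, hb, hab, rfl⟩ := hz
  refine ⟨b, ⟨hb, by linarith⟩, ?_, ?_⟩
  · simp only [Complex.add_re, Complex.smul_re, smul_eq_mul, Prod.fst_add, Int.cast_add]
    linear_combination (P.1 : ℝ) * hab
  · simp only [Complex.add_im, Complex.smul_im, smul_eq_mul, Prod.snd_add, Int.cast_add]
    linear_combination (P.2 : ℝ) * hab

/-- From congruent indices to a multiple of the period (the format of `IsSimplePolygon`).
[folklore] -/
theorem exists_eq_add_mul_of_emod {i j : ℤ} (h : j % ℓ = i % ℓ) : ∃ m : ℤ, j = i + m * ℓ :=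
  ⟨(j - i) / ℓ, by
    have hd : (ℓ : ℤ) ∣ j - i := Int.ModEq.dvd h.symm
    have := Int.ediv_mul_cancel hd
    linarith⟩

/-- **A simple closed walk on the triangular lattice of period at least `3` is a simple closed
polygon** in the sense of the tree's `IsSimplePolygon` (Hopf's hypotheses: non-adjacent closed
edges disjoint, adjacent ones meeting only at the common vertex). [cite: Hopf1935, Satz I] -/
theorem isSimplePolygon_vtx (hs : ∀ i j, c.v i = c.v j → i % ℓ = j % ℓ) (hn : 3 ≤ ℓ) :
    IsSimplePolygon c.vtx ℓ where
  three_le := hn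
  periodic := c.vtx_periodic
  ne_succ i := by
    have hn0 : 0 < ℓ := by omega
    obtain ⟨m, -, hm⟩ := exists_nat_repr hn0 i
    rw [c.vtx_add_one hm, c.vtx_eq_of_emod_eq hm]
    intro h
    have h' := pt_injective h
    rcases c.step_coord m with e | e | e | e | e | e <;> simp only [Prod.ext_iff] at h' <;> omega
  disjoint i j h0 h1 h2 := by
    have hn0 : 0 < ℓ := by omega
    obtain ⟨a, ha, hia⟩ := exists_nat_repr hn0 i
    obtain ⟨b, hb, hjb⟩ := exists_nat_repr hn0 j
    -- the four endpoints are pairwise distinct vertices of the walk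
    have nab : c.v a ≠ c.v b := fun h => by
      have := hs a b h
      rw [Nat.mod_eq_of_lt ha, Nat.mod_eq_of_lt hb] at this
      subst this
      obtain ⟨m, hm⟩ := exists_eq_add_mul_of_emod (hjb.trans hia.symm)
      exact h0 m hm
    have nab1 : c.v a ≠ c.v (b + 1) := fun h => by
      have hmod := hs a (b + 1) h
      rw [Nat.mod_eq_of_lt ha] at hmod
      have h3 : (a : ℤ) ≡ (b : ℤ) + 1 [ZMOD ℓ] := by
        have e : (a : ℤ) = (((b + 1) % ℓ : ℕ) : ℤ) := by exact_mod_cast hmod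
        rw [Int.ModEq, e, Int.natCast_mod]; push_cast; exact Int.emod_emod_of_dvd _ dvd_rfl
      have h4 : j ≡ i - 1 [ZMOD ℓ] :=
        calc j ≡ b [ZMOD ℓ] := hjb
          _ = (b + 1) - 1 := by ring
          _ ≡ a - 1 [ZMOD ℓ] := (h3.sub_right 1).symm
          _ ≡ i - 1 [ZMOD ℓ] := (Int.ModEq.sub_right 1 hia).symm
      obtain ⟨m, hm⟩ := exists_eq_add_mul_of_emod h4
      exact h2 m hm
    have na1b : c.v (a + 1) ≠ c.v b := fun h => by
      have hmod := hs (a + 1) b h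
      rw [Nat.mod_eq_of_lt hb] at hmod
      have h3 : (b : ℤ) ≡ (a : ℤ) + 1 [ZMOD ℓ] := by
        have e : (b : ℤ) = (((a + 1) % ℓ : ℕ) : ℤ) := by exact_mod_cast hmod.symm
        rw [Int.ModEq, e, Int.natCast_mod]; push_cast; exact Int.emod_emod_of_dvd _ dvd_rfl
      have h4 : j ≡ i + 1 [ZMOD ℓ] :=
        calc j ≡ b [ZMOD ℓ] := hjb
          _ ≡ a + 1 [ZMOD ℓ] := h3
          _ ≡ i + 1 [ZMOD ℓ] := (Int.ModEq.add_right 1 hia).symm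
      obtain ⟨m, hm⟩ := exists_eq_add_mul_of_emod h4
      exact h1 m hm
    have na1b1 : c.v (a + 1) ≠ c.v (b + 1) := fun h => by
      have hmod := hs (a + 1) (b + 1) h
      have hab : a % ℓ = b % ℓ := Nat.ModEq.add_right_cancel' 1 hmod
      rw [Nat.mod_eq_of_lt ha, Nat.mod_eq_of_lt hb] at hab
      subst hab
      obtain ⟨m, hm⟩ := exists_eq_add_mul_of_emod (hjb.trans hia.symm)
      exact h0 m hm
    -- the two edges as `[P, P + d]` and `[Q, Q + e]`
    have hd := c.next_eq a
    have he := c.next_eq b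
    rw [c.vtx_eq_of_emod_eq hia, c.vtx_add_one hia, c.vtx_eq_of_emod_eq hjb,
      c.vtx_add_one hjb]
    generalize c.v a = P at nab nab1 na1b na1b1 hd
    generalize c.v b = Q at nab nab1 na1b na1b1 he
    generalize c.v (a + 1) = P' at nab nab1 na1b na1b1 hd
    generalize c.v (b + 1) = Q' at nab nab1 na1b na1b1 he
    obtain ⟨d, rfl, hd'⟩ : ∃ d, P' = P + d ∧ (d = (1, 0) ∨ d = (-1, 0) ∨ d = (0, 1) ∨ d = (0, -1) ∨
        d = (1, -1) ∨ d = (-1, 1)) := by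
      rcases hd with h | h | h | h | h | h <;> exact ⟨_, h, by simp⟩
    obtain ⟨e, rfl, he'⟩ : ∃ e, Q' = Q + e ∧ (e = (1, 0) ∨ e = (-1, 0) ∨ e = (0, 1) ∨ e = (0, -1) ∨
        e = (1, -1) ∨ e = (-1, 1)) := by
      rcases he with h | h | h | h | h | h <;> exact ⟨_, h, by simp⟩
    refine Set.disjoint_left.2 fun z hz1 hz2 => ?_
    obtain ⟨s, hs01, hs1, hs2⟩ := exists_param_of_mem_segment hz1
    obtain ⟨t, ht01, ht1, ht2⟩ := exists_param_of_mem_segment hz2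
    rcases endpoint_of_meet hd' he' hs01 ht01 (hs1.symm.trans ht1) (hs2.symm.trans ht2) with
      h | h | h | h
    · exact nab h
    · exact nab1 h
    · exact na1b h
    · exact na1b1 h
  adjacent i := by
    have hn0 : 0 < ℓ := by omega
    obtain ⟨a, -, hia⟩ := exists_nat_repr hn0 (i - 1)
    have hi : i % ℓ = ((a + 1 : ℕ) : ℤ) % ℓ := by
      have := Int.ModEq.add_right 1 hia
      rw [sub_add_cancel] at this
      push_cast
      exact this
    rw [c.vtx_eq_of_emod_eq hia, c.vtx_eq_of_emod_eq hi, c.vtx_add_one hi]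
    have hpq := c.v_ne_v_add_two hs hn a
    have hp := c.prev_eq a
    have hq := c.next_eq (a + 1)
    rw [show a + 1 + 1 = a + 2 from rfl] at hq ⊢
    generalize c.v a = P at hpq hp
    generalize c.v (a + 2) = Q at hpq hq
    generalize c.v (a + 1) = u at hp hq
    obtain ⟨p, rfl, hp'⟩ : ∃ p, P = u + p ∧ (p = (1, 0) ∨ p = (-1, 0) ∨ p = (0, 1) ∨ p = (0, -1) ∨
        p = (1, -1) ∨ p = (-1, 1)) := by
      rcases hp with h | h | h | h | h | h <;> exact ⟨_, h, by simp⟩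
    obtain ⟨q, rfl, hq'⟩ : ∃ q, Q = u + q ∧ (q = (1, 0) ∨ q = (-1, 0) ∨ q = (0, 1) ∨ q = (0, -1) ∨
        q = (1, -1) ∨ q = (-1, 1)) := by
      rcases hq with h | h | h | h | h | h <;> exact ⟨_, h, by simp⟩
    have hpq' : p ≠ q := fun h => hpq (by rw [h])
    intro z ⟨hz1, hz2⟩
    -- `z = u + s p` (read on the first edge from `u` backwards) and `z = u + t q`
    have hz1' : z ∈ segment ℝ (⟨((u).1 : ℝ), ((u).2 : ℝ)⟩ : ℂ) ⟨((u + p).1 : ℝ), ((u + p).2 : ℝ)⟩ := by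
      rw [segment_symm]; exact hz1
    obtain ⟨s, hs01, hs1, hs2⟩ := exists_param_of_mem_segment hz1'
    obtain ⟨t, ht01, ht1, ht2⟩ := exists_param_of_mem_segment hz2
    have hs0 : s = 0 := param_eq_zero_of_meet hp' hq' hpq' hs01 ht01 (by linarith) (by linarith)
    subst hs0
    rw [Set.mem_singleton_iff]
    apply Complex.ext <;> simp [hs1, hs2]

/-- **The exterior angles of the polygon of a simple walk are `π/4 · turn`.** At the vertex with
index `i ≡ m + 1`, the exterior angle of `IsSimplePolygon` is `π/4` times the turn from the step
`v m → v (m+1)` to the step `v (m+1) → v (m+2)`. [folklore] -/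
theorem extAngle_vtx (hs : ∀ i j, c.v i = c.v j → i % ℓ = j % ℓ) (hn : 3 ≤ ℓ) {i : ℤ} {m : ℕ}
    (h : (i - 1) % ℓ = (m : ℤ) % ℓ) :
    extAngle c.vtx i = Real.pi / 4 * (turn (c.v (m + 1) - c.v m) (c.v (m + 2) - c.v (m + 1)) : ℝ) := by
  have hn0 : 0 < ℓ := by omega
  have hi : i % ℓ = ((m + 1 : ℕ) : ℤ) % ℓ := by
    have := Int.ModEq.add_right 1 h
    rw [sub_add_cancel] at this
    push_cast
    exact this
  unfold extAngle
  rw [c.vtx_eq_of_emod_eq h, c.vtx_eq_of_emod_eq hi]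
  have hpq := c.v_ne_v_add_two hs hn m
  have hd := c.next_eq m
  have he := c.next_eq (m + 1)
  rw [show m + 1 + 1 = m + 2 from rfl] at he
  obtain ⟨d, hd1, hd'⟩ : ∃ d, c.v (m + 1) = c.v m + d ∧ (d = (1, 0) ∨ d = (-1, 0) ∨ d = (0, 1) ∨
      d = (0, -1) ∨ d = (1, -1) ∨ d = (-1, 1)) := by
    rcases hd with h | h | h | h | h | h <;> exact ⟨_, h, by simp⟩
  obtain ⟨e, he1, he'⟩ : ∃ e, c.v (m + 2) = c.v (m + 1) + e ∧ (e = (1, 0) ∨ e = (-1, 0) ∨ e = (0, 1) ∨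
      e = (0, -1) ∨ e = (1, -1) ∨ e = (-1, 1)) := by
    rcases he with h | h | h | h | h | h <;> exact ⟨_, h, by simp⟩
  have hne : d + e ≠ 0 := fun h0 => hpq (by
    rw [he1, hd1, add_assoc, h0, add_zero])
  have key := pickParity_arg_div_eq_turn hd' he' hne
  rw [c.vtx_add_one hi, show m + 1 + 1 = m + 2 from rfl, he1, hd1]
  have hnum : ((⟨((c.v m + d + e).1 : ℝ), ((c.v m + d + e).2 : ℝ)⟩ : ℂ) - ⟨((c.v m + d).1 : ℝ), ((c.v m + d).2 : ℝ)⟩) =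
      ⟨(e.1 : ℝ), (e.2 : ℝ)⟩ := by
    apply Complex.ext <;> simp
  have hden : ((⟨((c.v m + d).1 : ℝ), ((c.v m + d).2 : ℝ)⟩ : ℂ) - ⟨((c.v m).1 : ℝ), ((c.v m).2 : ℝ)⟩) =
      ⟨(d.1 : ℝ), (d.2 : ℝ)⟩ := by
    apply Complex.ext <;> simp
  rw [hnum, hden, add_sub_cancel_left, add_sub_cancel_left]
  exact key

/-- A periodic sum is invariant under shifts of the index. [folklore] -/
theorem sum_range_add_of_periodic {g : ℕ → ℤ} (hg : ∀ j, g (j + ℓ) = g j) (k : ℕ) :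
    ∑ j ∈ range ℓ, g (j + k) = ∑ j ∈ range ℓ, g j := by
  induction k with
  | zero => simp
  | succ k ih =>
    rw [← ih]
    have e : ∀ j, g (j + (k + 1)) = g (j + 1 + k) := fun j => by rw [add_assoc, add_comm 1 k]
    rw [sum_congr rfl fun j _ => e j]
    exact sum_range_succ_of_periodic (g := fun j => g (j + k)) (by
      show g (ℓ + k) = g (0 + k)
      rw [zero_add, add_comm, hg])

/-- **The turning number of a simple closed triangular-lattice walk is `±8`** (in units of `45°`):
Hopf's Umlaufsatz `IsSimplePolygon.sum_extAngle_eq` for the polygon `vtx`, whose exterior angles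
are `π/4 · turn`. [cite: Hopf1935, Satz I] -/
theorem sum_turn_eq (hs : ∀ i j, c.v i = c.v j → i % ℓ = j % ℓ) (hn : 3 ≤ ℓ) :
    ∑ j ∈ range ℓ, turn (c.v (j + 1) - c.v j) (c.v (j + 2) - c.v (j + 1)) = 8 ∨
      ∑ j ∈ range ℓ, turn (c.v (j + 1) - c.v j) (c.v (j + 2) - c.v (j + 1)) = -8 := by
  have hn0 : 0 < ℓ := by omega
  set T : ℕ → ℤ := fun j => turn (c.v (j + 1) - c.v j) (c.v (j + 2) - c.v (j + 1)) with hT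
  have hTper : ∀ j, T (j + ℓ) = T j := fun j => by
    simp only [hT]
    rw [show j + ℓ + 1 = j + 1 + ℓ by ring, show j + ℓ + 2 = j + 2 + ℓ by ring, c.periodic,
      c.periodic, c.periodic]
  -- the exterior angle at the natural index `i` is `π/4 · T (i + (ℓ - 1))`
  have hext : ∀ i : ℕ, extAngle c.vtx i = Real.pi / 4 * (T (i + (ℓ - 1)) : ℝ) := by
    intro i
    have h : ((i : ℤ) - 1) % ℓ = ((i + (ℓ - 1) : ℕ) : ℤ) % ℓ := by
      push_cast [Nat.cast_sub hn0]
      rw [show (i : ℤ) + ((ℓ : ℤ) - 1) = (i : ℤ) - 1 + ℓ by ring, Int.add_emod_right]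
    rw [c.extAngle_vtx hs hn h]
  have hsum : ∑ i ∈ range ℓ, extAngle c.vtx i = Real.pi / 4 * ((∑ j ∈ range ℓ, T j : ℤ) : ℝ) := by
    rw [sum_congr rfl fun i _ => hext i, ← mul_sum, ← sum_range_add_of_periodic hTper (ℓ - 1),
      Int.cast_sum]
  have key := (c.isSimplePolygon_vtx hs hn).sum_extAngle_eq
  rw [hsum] at key
  have hpi : Real.pi ≠ 0 := Real.pi_ne_zero
  rcases key with h | h
  · left
    have h' : Real.pi * ((∑ j ∈ range ℓ, T j : ℤ) : ℝ) = Real.pi * 8 := by linarith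
    exact_mod_cast mul_left_cancel₀ hpi h'
  · right
    have h' : Real.pi * ((∑ j ∈ range ℓ, T j : ℤ) : ℝ) = Real.pi * (-8) := by linarith
    exact_mod_cast mul_left_cancel₀ hpi h'

end TriWalk

/-- **The turning number of a simple closed triangular-lattice walk is `±8`** (closed form of
`TriWalk.sum_turn_eq`; registered sub-goal `pickParity_sum_turn_eq` of stmt-ValiantsHypothesis-5066,
fourth milestone of stub `stub_pickParity`). [cite: Hopf1935, Satz I] -/
theorem pickParity_sum_turn_eq : ∀ {ℓ : ℕ} (c : Summit.ValiantsHypothesis.ValiantsHypothesis.Theorems.DivisionGapZeroOneTransfer.TriWalk ℓ), (∀ i j, c.v i = c.v j → i % ℓ = j % ℓ) → 3 ≤ ℓ → ∑ j ∈ Finset.range ℓ, Summit.ValiantsHypothesis.ValiantsHypothesis.Theorems.DivisionGapZeroOneTransfer.turn (c.v (j + 1) - c.v j) (c.v (j + 2) - c.v (j + 1)) = 8 ∨ ∑ j ∈ Finset.range ℓ, Summit.ValiantsHypothesis.ValiantsHypothesis.Theorems.DivisionGapZeroOneTransfer.turn (c.v (j + 1) - c.v j) (c.v (j + 2) - c.v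 (j + 1)) = -8 :=
  fun c hs hn => c.sum_turn_eq hs hn

end Summit.ValiantsHypothesis.ValiantsHypothesis.Theorems.DivisionGapZeroOneTransfer
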